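import Summits.Ventures.DiscreteObjects.Hadamard.OrbitRepsPMTools
import Summits.Ventures.DiscreteObjects.Hadamard.FixedGramModP

/-!
# Hadamard 668 census, family F12 — an automorphism of order 25 of an H(668) fixes EXACTLY 8 rows and 8 columns
# (kernel, structure: the case 18 is excluded by orbit-sign vectors, a Hamming inequality and the Welch bound)

Framing: lottery ticket; floor = certified bounds/negative ranges.

Cell pub-namedobj (venture DiscreteObjects), target (H), hadamard gen 18.  After `FixedGramModP` (`#Fix π = #Fix κ = f ∈
{8, 18}`) and `Order25FifthPowerFixed668` (fifth powers fix exactly `68`), this file removes `f = 18`.  Write the columns as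
`C = Fix κ` (`18`), `U = Fix κ⁵ ∖ Fix κ` (`50`, ten `κ`-orbits of size `5`) and `W` = moved by `κ⁵` (`600`, twenty-four
`κ`-orbits of size `25`); choose orbit representatives `T_U` (`10`) and `T_W` (`24`) (`exists_orbit_reps`: a free action
with pointwise period `n` on a stable finset has a transversal `T` with `n·|T| = |Y|` and `Σ_Y g = n·Σ_T g` for every
`κ`-invariant `g`).  For two of the `18` `π`-fixed rows `x ≠ x'` (equal signs) the `κ`-invariant `g = H x · H x' ·` sums
to `0`, so `S + 5a + 25b = 0` with `S = Σ_C g` (`|S| ≤ 18`), `a = Σ_{T_U} g` (`|a| ≤ 10`), `b = Σ_{T_W} g` (`|b| ≤ 24`),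
all three sums of `±1`'s; hence `b ∈ {0, ±2}`, `b ≠ 0 ⇒ |a| ≥ 8`, `b = 0 ⇒ |a| ≤ 2`.  Tools on `±1` vectors over a finset
`T`: `pm_three_inner_mod4` (`4 ∣ |T| + ⟨z₁,z₂⟩ + ⟨z₁,z₃⟩ + ⟨z₂,z₃⟩`), `pm_inner_triangle(_abs)` (`⟨q,r⟩ ≥ ⟨q,p⟩ + ⟨p,r⟩ − |T|`,
the Hamming triangle inequality), `pm_welch` (`|T|·|X|² ≤ Σ_{x,y∈X} ⟨v_x,v_y⟩²`).  ENDGAME: if some pair has `b ≠ 0`, a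
third row `w` has exactly one of `b_{xw}, b_{yw}` non-zero (mod-4 rule on `T_W`, `|T_W| = 24`), say `b_{xw} ≠ 0`; then
`|a_{xy}|, |a_{xw}| ≥ 8` give `|a_{yw}| ≥ 6` (triangle on `T_U`, `|T_U| = 10`), contradicting `b_{yw} = 0 ⇒ |a_{yw}| ≤ 2`;
so all `b = 0`, all off-diagonal `|a| ≤ 2`, and the Welch bound `10·18² = 3240 ≤ Σ a² ≤ 18·10² + 18·17·4 = 3024` fails.
**`hadamard668_order25_fixed_eight`**: pair-order `25` ⇒ `#Fix π = #Fix κ = 8` (and `#Fix π⁵ = #Fix κ⁵ = 68`).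
STRUCTURE only: order `25` is NOT excluded (`f = 8` survives the fixed-row analysis).  Ours, not literature; no
`sorry`, no definitions, default heartbeats.
-/

namespace Summit.Ventures.DiscreteObjects.Hadamard

open Finset BigOperators Matrix

open Literature.Combinatorics.Designs.GoethalsSeidel (IsHadamardMatrix)

variable {ι : Type*} [Fintype ι] [DecidableEq ι]

/-! ### order 25: the element fixes exactly 8 -/

section main
variable {H : Matrix ι ι ℤ}

/-- columns: `#Fix κ = 8` for an automorphism of pair-order `25` of an H(668) -/
lemma order25_cols_eight (hH : IsHadamardMatrix H) (hι : Fintype.card ι = 668)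
    {π κ : Equiv.Perm ι} {d e : ι → ℤ} (haut : IsSignedAut H π κ d e)
    (hπ : π ^ 25 = 1) (hκ : κ ^ 25 = 1) (hne : π ^ 5 ≠ 1 ∨ κ ^ 5 ≠ 1) :
    (univ.filter fun j => κ j = j).card = 8 := by
  obtain ⟨heq, h818⟩ := hadamard668_order25_fixed_eq hH hι π κ d e haut hπ hκ hne
  obtain ⟨-, hC68⟩ := hadamard668_order25_pow5_fixed hH hι π κ d e haut hπ hκ hne
  rcases h818 with h8 | h18
  · exact h8
  exfalso
  -- names for the row set and the three column classes (opaque, with defining equations)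
  obtain ⟨R, hRdef⟩ : ∃ R : Finset ι, R = univ.filter (fun i => π i = i) := ⟨_, rfl⟩
  obtain ⟨C, hCdef⟩ : ∃ C : Finset ι, C = univ.filter (fun j => κ j = j) := ⟨_, rfl⟩
  obtain ⟨U, hUdef⟩ : ∃ U : Finset ι,
      U = (univ.filter fun j => (κ ^ 5) j = j).filter (fun j => ¬ κ j = j) := ⟨_, rfl⟩
  obtain ⟨W, hWdef⟩ : ∃ W : Finset ι, W = univ.filter (fun j => ¬ (κ ^ 5) j = j) := ⟨_, rfl⟩
  rw [← hRdef, ← hCdef] at heq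
  rw [← hCdef] at h18
  have hR18 : R.card = 18 := by rw [heq]; exact h18
  have hmemR : ∀ {x}, x ∈ R → π x = x := by
    intro x hx; rw [hRdef] at hx; simpa using hx
  have hCsub : (univ.filter fun j => (κ ^ 5) j = j).filter (fun j => κ j = j) = C := by
    ext j
    rw [hCdef]
    simp only [Finset.mem_filter, Finset.mem_univ, true_and]
    exact ⟨fun h => h.2, fun h => ⟨perm_pow_apply_of_fixed κ h 5, h⟩⟩
  have hU50 : U.card = 50 := by
    have h := Finset.card_filter_add_card_filter_not (s := univ.filter fun j => (κ ^ 5) j = j)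
      (fun j => κ j = j)
    rw [hCsub, ← hUdef, hC68, h18] at h
    omega
  have hW600 : W.card = 600 := by
    have h := Finset.card_filter_add_card_filter_not (s := (univ : Finset ι)) (fun j => (κ ^ 5) j = j)
    rw [← hWdef, hC68, Finset.card_univ, hι] at h
    omega
  -- orbit representatives
  have hκ55 : κ ^ (5 * 5) = 1 := hκ
  obtain ⟨TU, -, hTUcard, hTUsum⟩ := exists_orbit_reps κ (n := 5) (by norm_num) U.card U le_rfl
    (by
      intro y hy
      rw [hUdef] at hy ⊢
      simp only [Finset.mem_filter, Finset.mem_univ, true_and] at hy ⊢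
      refine ⟨by rw [pow_apply_comm κ 5 y, hy.1], fun h => hy.2 (κ.injective h)⟩)
    (by
      intro y hy
      rw [hUdef] at hy
      simp only [Finset.mem_filter, Finset.mem_univ, true_and] at hy
      exact hy.1)
    (by
      intro y hy
      rw [hUdef] at hy
      simp only [Finset.mem_filter, Finset.mem_univ, true_and] at hy
      exact free_of_fixed_prime_pow κ (by norm_num : (5 : ℕ).Prime) hy.1 hy.2)
  obtain ⟨TW, -, hTWcard, hTWsum⟩ := exists_orbit_reps κ (n := 25) (by norm_num) W.card W le_rfl
    (by
      intro y hy
      rw [hWdef] at hy ⊢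
      simp only [Finset.mem_filter, Finset.mem_univ, true_and] at hy ⊢
      rw [pow_apply_comm κ 5 y]
      exact fun h => hy (κ.injective h))
    (by intro y _; rw [hκ, Equiv.Perm.one_apply])
    (by
      intro y hy
      rw [hWdef] at hy
      simp only [Finset.mem_filter, Finset.mem_univ, true_and] at hy
      exact free_of_moved_pow κ (by norm_num : (5 : ℕ).Prime) hκ55 hy)
  have hTU10 : TU.card = 10 := by rw [hU50] at hTUcard; omega
  have hTW24 : TW.card = 24 := by rw [hW600] at hTWcard; omega
  -- signs of the fixed rows
  have h0 : 0 < C.card := by rw [h18]; norm_num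
  obtain ⟨j₀, hj₀⟩ := Finset.card_pos.mp h0
  rw [hCdef] at hj₀
  simp only [Finset.mem_filter, Finset.mem_univ, true_and] at hj₀
  have hd : ∀ x ∈ R, d x = e j₀ := fun x hx => signedAut_fixed_sign hH.1 haut (hmemR hx) hj₀
  have hpm : ∀ x y : ι, H x y = 1 ∨ H x y = -1 := hH.1
  -- the pair relation S + 5a + 25b = 0 and its consequences
  have hpair : ∀ x ∈ R, ∀ x' ∈ R, x ≠ x' →
      (∑ t ∈ TW, H x t * H x' t = 0 ∧ |∑ t ∈ TU, H x t * H x' t| ≤ 2) ∨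
      ((∑ t ∈ TW, H x t * H x' t = 2 ∨ ∑ t ∈ TW, H x t * H x' t = -2) ∧
        8 ≤ |∑ t ∈ TU, H x t * H x' t|) := by
    intro x hx x' hx' hxx'
    have hxf : π x = x := hmemR hx
    have hx'f : π x' = x' := hmemR hx'
    have hinv : ∀ y, H x (κ y) * H x' (κ y) = H x y * H x' y := by
      intro y
      have h1 := haut.2.2 x y; have h2 := haut.2.2 x' y
      rw [hxf] at h1; rw [hx'f] at h2
      rw [h1, h2, hd x hx, hd x' hx']
      have hd2 : e j₀ * e j₀ = 1 := pm_mul_self (haut.2.1 j₀)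
      have he2 : e y * e y = 1 := pm_mul_self (haut.2.1 y)
      calc e j₀ * e y * H x y * (e j₀ * e y * H x' y) = (e j₀ * e j₀) * (e y * e y) * (H x y * H x' y) := by ring
        _ = H x y * H x' y := by rw [hd2, he2, one_mul, one_mul]
    -- 0 = S + Σ_U + Σ_W
    have horth : ∑ y, H x y * H x' y = 0 := hadamard_row_orth H hH hxx'
    have hs1 := Finset.sum_filter_add_sum_filter_not (univ : Finset ι) (fun j => (κ ^ 5) j = j)
      (fun y => H x y * H x' y)
    have hs2 := Finset.sum_filter_add_sum_filter_not (univ.filter fun j => (κ ^ 5) j = j) (fun j => κ j = j)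
      (fun y => H x y * H x' y)
    rw [hCsub, ← hUdef] at hs2
    rw [horth, ← hs2, ← hWdef, hTUsum _ hinv, hTWsum _ hinv] at hs1
    -- bounds
    obtain ⟨m₁, hm₁, hS⟩ := sum_pm_eq_card_sub_two_mul C (fun y => H x y * H x' y)
      (fun y _ => by rcases hpm x y with h1 | h1 <;> rcases hpm x' y with h2 | h2 <;> simp [h1, h2])
    obtain ⟨m₂, hm₂, ha⟩ := sum_pm_eq_card_sub_two_mul TU (fun y => H x y * H x' y)
      (fun y _ => by rcases hpm x y with h1 | h1 <;> rcases hpm x' y with h2 | h2 <;> simp [h1, h2])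
    obtain ⟨m₃, hm₃, hb⟩ := sum_pm_eq_card_sub_two_mul TW (fun y => H x y * H x' y)
      (fun y _ => by rcases hpm x y with h1 | h1 <;> rcases hpm x' y with h2 | h2 <;> simp [h1, h2])
    rw [h18] at hm₁ hS
    rw [hTU10] at hm₂ ha
    rw [hTW24] at hm₃ hb
    rw [hS, ha, hb] at hs1
    rw [ha, hb]
    push_cast at hs1 ⊢
    have hm3 : m₃ = 11 ∨ m₃ = 12 ∨ m₃ = 13 := by omega
    rcases hm3 with rfl | rfl | rfl
    · right
      refine ⟨by left; omega, ?_⟩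
      rw [le_abs]; omega
    · left
      refine ⟨by omega, ?_⟩
      rw [abs_le]; omega
    · right
      refine ⟨by right; omega, ?_⟩
      rw [le_abs]; omega
  -- symmetry of the inner products
  have hsymU : ∀ x x' : ι, ∑ t ∈ TU, H x t * H x' t = ∑ t ∈ TU, H x' t * H x t :=
    fun x x' => Finset.sum_congr rfl (fun t _ => mul_comm _ _)
  have hsymW : ∀ x x' : ι, ∑ t ∈ TW, H x t * H x' t = ∑ t ∈ TW, H x' t * H x t :=
    fun x x' => Finset.sum_congr rfl (fun t _ => mul_comm _ _)
  have hpmU : ∀ x, ∀ t ∈ TU, H x t = 1 ∨ H x t = -1 := fun x t _ => hpm x t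
  have hpmW : ∀ x, ∀ t ∈ TW, H x t = 1 ∨ H x t = -1 := fun x t _ => hpm x t
  by_cases hex : ∃ x ∈ R, ∃ y ∈ R, x ≠ y ∧ ∑ t ∈ TW, H x t * H y t ≠ 0
  · -- a pair with b ≠ 0 and a third row w
    obtain ⟨x, hx, y, hy, hxy, hbxy⟩ := hex
    obtain ⟨w, hw, hwx, hwy⟩ : ∃ w ∈ R, w ≠ x ∧ w ≠ y := by
      have hc : 0 < ((R.erase x).erase y).card := by
        have h1 := Finset.card_erase_of_mem hx
        have h2 := Finset.pred_card_le_card_erase (s := R.erase x) (a := y)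
        omega
      obtain ⟨w, hw⟩ := Finset.card_pos.mp hc
      rw [Finset.mem_erase, Finset.mem_erase] at hw
      exact ⟨w, hw.2.2, hw.2.1, hw.1⟩
    have hmod := pm_three_inner_mod4 TW (H x) (H y) (H w) (hpmW x) (hpmW y) (hpmW w)
    rw [hTW24] at hmod
    obtain ⟨c, hc⟩ := hmod
    push_cast at hc
    have hxy' := hpair x hx y hy hxy
    have hxw' := hpair x hx w hw hwx.symm
    have hyw' := hpair y hy w hw hwy.symm
    have haxy : 8 ≤ |∑ t ∈ TU, H x t * H y t| := by
      rcases hxy' with ⟨h0, -⟩ | ⟨-, h8⟩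
      · exact absurd h0 hbxy
      · exact h8
    have hbxy2 : ∑ t ∈ TW, H x t * H y t = 2 ∨ ∑ t ∈ TW, H x t * H y t = -2 := by
      rcases hxy' with ⟨h0, -⟩ | ⟨h2, -⟩
      · exact absurd h0 hbxy
      · exact h2
    rcases hxw' with ⟨hbxw0, haxw⟩ | ⟨hbxw, haxw⟩
    · rcases hyw' with ⟨hbyw0, hayw⟩ | ⟨hbyw, hayw⟩
      · -- only b_xy ≠ 0: parity
        rw [hbxw0, hbyw0] at hc
        rcases hbxy2 with h2 | h2 <;> rw [h2] at hc <;> omega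
      · -- |a_xy|, |a_yw| ≥ 8 ⇒ |a_xw| ≥ 6 > 2
        have htri := pm_inner_triangle_abs TU (H y) (H x) (H w) (hpmU y) (hpmU x) (hpmU w)
        rw [hTU10] at htri
        push_cast at htri
        linarith
    · rcases hyw' with ⟨hbyw0, hayw⟩ | ⟨hbyw, hayw⟩
      · -- |a_yx|, |a_xw| ≥ 8 ⇒ |a_yw| ≥ 6 > 2
        have htri := pm_inner_triangle_abs TU (H x) (H y) (H w) (hpmU x) (hpmU y) (hpmU w)
        rw [hTU10, ← hsymU x y] at htri
        push_cast at htri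
        linarith
      · -- three non-zero b's: parity
        rcases hbxy2 with h2 | h2 <;> rcases hbxw with h4 | h4 <;> rcases hbyw with h5 | h5 <;>
          rw [h2, h4, h5] at hc <;> omega
  · -- all b = 0: Welch
    push Not at hex
    have hsmall : ∀ x ∈ R, ∀ y ∈ R, x ≠ y → (∑ t ∈ TU, H x t * H y t) ^ 2 ≤ 4 := by
      intro x hx y hy hxy
      rcases hpair x hx y hy hxy with ⟨-, h2⟩ | ⟨hb, -⟩
      · rw [abs_le] at h2; nlinarith [h2.1, h2.2]
      · exfalso
        have h0 := hex x hx y hy hxy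
        rcases hb with h | h <;> rw [h] at h0 <;> norm_num at h0
    have hdiagv : ∀ x, (∑ t ∈ TU, H x t * H x t) = 10 := by
      intro x
      rw [Finset.sum_congr rfl (fun t _ => pm_mul_self (hpm x t)), Finset.sum_const, hTU10]; simp
    have hupper : ∑ x ∈ R, ∑ y ∈ R, (∑ t ∈ TU, H x t * H y t) ^ 2 ≤ 18 * (100 + 17 * 4) := by
      have hrow : ∀ x ∈ R, ∑ y ∈ R, (∑ t ∈ TU, H x t * H y t) ^ 2 ≤ 100 + 17 * 4 := by
        intro x hx
        rw [← Finset.add_sum_erase R _ hx, hdiagv x]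
        have hrest : ∑ y ∈ R.erase x, (∑ t ∈ TU, H x t * H y t) ^ 2 ≤ (R.erase x).card • (4 : ℤ) :=
          Finset.sum_le_card_nsmul _ _ _ (fun y hy => by
            rw [Finset.mem_erase] at hy
            exact hsmall x hx y hy.2 (Ne.symm hy.1))
        rw [Finset.card_erase_of_mem hx, hR18] at hrest
        norm_num at hrest ⊢
        linarith
      calc ∑ x ∈ R, ∑ y ∈ R, (∑ t ∈ TU, H x t * H y t) ^ 2 ≤ ∑ x ∈ R, (100 + 17 * 4 : ℤ) :=
            Finset.sum_le_sum hrow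
        _ = 18 * (100 + 17 * 4) := by rw [Finset.sum_const, hR18]; simp
    have hwelch := pm_welch R TU (fun x t => H x t) (fun x _ t _ => hpm x t)
    rw [hTU10, hR18] at hwelch
    norm_num at hwelch hupper
    linarith

/-- **An automorphism of order 25 of an H(668) fixes exactly 8 rows and 8 columns** (and its 5th power exactly 68):
for a signed automorphism `(π, κ, d, e)` with `π^25 = κ^25 = 1` and `(π⁵, κ⁵) ≠ (1, 1)`.  Structure only. -/
theorem hadamard668_order25_fixed_eight (hH : IsHadamardMatrix H) (hι : Fintype.card ι = 668)
    (π κ : Equiv.Perm ι) (d e : ι → ℤ) (haut : IsSignedAut H π κ d e)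
    (hπ : π ^ 25 = 1) (hκ : κ ^ 25 = 1) (hne : π ^ 5 ≠ 1 ∨ κ ^ 5 ≠ 1) :
    (univ.filter fun i => π i = i).card = 8 ∧ (univ.filter fun j => κ j = j).card = 8 ∧
    (univ.filter fun i => (π ^ 5) i = i).card = 68 ∧ (univ.filter fun j => (κ ^ 5) j = j).card = 68 := by
  obtain ⟨heq, -⟩ := hadamard668_order25_fixed_eq hH hι π κ d e haut hπ hκ hne
  obtain ⟨hR68, hC68⟩ := hadamard668_order25_pow5_fixed hH hι π κ d e haut hπ hκ hne
  have hC8 := order25_cols_eight hH hι haut hπ hκ hne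
  exact ⟨by rw [heq]; exact hC8, hC8, hR68, hC68⟩

end main

end Summit.Ventures.DiscreteObjects.Hadamard
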